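import Mathlib
import Literature.AlgebraicGeometry.Resolution.CompleteLocalDomainNormalizationPowerSeries
import Literature.AlgebraicGeometry.Resolution.FormalFibres
import Summits.ResolutionOfSingularities.ResolutionOfSingularities.Theorems.WeightedInvariantLocalWeightedDropNCBranchPrimesFinite

/-!
# TOT2-LINE (P3) brick B2: the BRANCH RING `k⟦u₁,u₂,y⟧ ⧸ P` of a top-locus prime and its CANONICAL VALUATION

Sub-problem `ResolutionOfSingularities`, ENGINE crux `stmt-ResolutionOfSingularities-8899` (`LocalWeightedDrop`), skeleton v35
(2e806da509994632), registered stub `stub_conflictBudget` (P3).  [OURS · L1 W4.3 · chain w43 · res-L1-w43-stub-2 g6; the valuation package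
of CONFLICT-BUDGET-DESIGN-v1 §6 B2 (evidence n=57 on 8899): every term of the conflict budget is a value of the canonical valuation of a
top-locus branch.  Engine bookkeeping; nothing here is a statement of any manuscript; AI-produced, gate-checked, weaker than expert review.]

For a prime `P` of `R₃ = k⟦X₀,X₁,X₂⟧`:
* §1 the branch ring `R₃ ⧸ P` is a complete Noetherian local domain; if `P ≠ 𝔪` lies strictly above a non-zero prime (e.g. `P` contains a
  squarefree `b` together with its partial derivatives — the top-locus primes of stub-1's (β-prime)) it has Krull dimension ONE
  (`ringKrullDim_quotient_eq_one`, `ringKrullDim_quotient_eq_one_of_squarefree`), so the tree's normalisation theorem applies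
  (`Literature.….isDiscreteValuationRing_integralClosure_of_complete`, Kiyek–Vicente II (3.17)): its normalisation `W_P` is a complete
  discrete valuation ring, finite and local over `R₃ ⧸ P`;
* §2 the CANONICAL VALUATION `v_P(f) := addVal_{W_P} (f mod P)` (no choices): `= ⊤` exactly on `P`, additive, `≥ 1` exactly on `𝔪`,
  `0` on units; the values of the variables are positive and finite off `P`;
* §3 the PARAMETRISATION READING: for the tree's branch parametrisation `τ : R₃ ⧸ P ↪ κ′⟦T⟧` (`exists_branchParametrization_of_complete`,
  Matsumura 29.7) one has `v_P(f) = ord_T τ(f mod P)` (`addVal_eq_order_of_ringEquiv`, `exists_param_valuation_eq_order`).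
-/

set_option linter.dupNamespace false -- mandated namespace of this single-conjunct summit

noncomputable section

namespace Summit.ResolutionOfSingularities.ResolutionOfSingularities.Theorems

namespace TOT2Branch

open MvPowerSeries IsLocalRing Literature.AlgebraicGeometry.Resolution

variable {k : Type} [Field k]

/-! ## §1 The branch ring `k⟦X₀,X₁,X₂⟧ ⧸ P` -/

section BranchRing

variable (P : Ideal (MvPowerSeries (Fin 3) k)) [hP : P.IsPrime]

/-- The branch ring is a local ring. -/
theorem isLocalRing_quotient : IsLocalRing (MvPowerSeries (Fin 3) k ⧸ P) :=
  IsLocalRing.of_surjective' _ Ideal.Quotient.mk_surjective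

/-- `k⟦X₀,X₁,X₂⟧` is complete for the adic topology of its maximal ideal. -/
theorem isAdicComplete_maximalIdeal : IsAdicComplete (maximalIdeal (MvPowerSeries (Fin 3) k)) (MvPowerSeries (Fin 3) k) := by
  rw [maximalIdeal_mvPowerSeries_eq_span k (Fin 3)]
  infer_instance

/-- The branch ring is complete for the adic topology of its maximal ideal. -/
theorem isAdicComplete_quotient :
    haveI := isLocalRing_quotient P
    IsAdicComplete (maximalIdeal (MvPowerSeries (Fin 3) k ⧸ P)) (MvPowerSeries (Fin 3) k ⧸ P) := by
  haveI := isLocalRing_quotient P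
  haveI : IsNoetherianRing (MvPowerSeries (Fin 3) k) := isNoetherianRing_mvPowerSeries k (Fin 3)
  haveI := isAdicComplete_maximalIdeal (k := k)
  exact Literature.AlgebraicGeometry.Resolution.isAdicComplete_quotient P

omit hP in
/-- The branch ring is Noetherian. -/
theorem isNoetherianRing_quotient : IsNoetherianRing (MvPowerSeries (Fin 3) k ⧸ P) := by
  haveI : IsNoetherianRing (MvPowerSeries (Fin 3) k) := isNoetherianRing_mvPowerSeries k (Fin 3)
  infer_instance

/-- A prime strictly between a non-zero prime and the maximal ideal has no prime strictly above it except `𝔪` (`dim k⟦X₀,X₁,X₂⟧ = 3`). -/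
theorem eq_or_eq_maximalIdeal_of_le {Q₀ : Ideal (MvPowerSeries (Fin 3) k)} [Q₀.IsPrime] (h₀ : ⊥ < Q₀) (h₁ : Q₀ < P)
    {Q : Ideal (MvPowerSeries (Fin 3) k)} [Q.IsPrime] (hPQ : P ≤ Q) :
    Q = P ∨ Q = maximalIdeal (MvPowerSeries (Fin 3) k) := by
  by_contra h
  rw [not_or] at h
  have h₂ : P < Q := lt_of_le_of_ne hPQ (fun e => h.1 e.symm)
  have h₃ : Q < maximalIdeal (MvPowerSeries (Fin 3) k) := lt_of_le_of_ne (IsLocalRing.le_maximalIdeal (Ideal.IsPrime.ne_top ‹_›)) h.2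
  haveI : (⊥ : Ideal (MvPowerSeries (Fin 3) k)).IsPrime := Ideal.isPrime_bot
  exact NCBranchPrimes.no_chain_four h₀ h₁ h₂ h₃

/-- **The branch ring has Krull dimension one** when `P ≠ 𝔪` lies strictly above a non-zero prime. -/
theorem ringKrullDim_quotient_eq_one {Q₀ : Ideal (MvPowerSeries (Fin 3) k)} [Q₀.IsPrime] (h₀ : ⊥ < Q₀) (h₁ : Q₀ < P)
    (hPm : P ≠ maximalIdeal (MvPowerSeries (Fin 3) k)) : ringKrullDim (MvPowerSeries (Fin 3) k ⧸ P) = 1 := by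
  rw [ringKrullDim_quotient]
  apply le_antisymm
  · rw [Order.krullDim_le_one_iff]
    rintro ⟨Q, hQ⟩
    have hPQ : P ≤ Q.asIdeal := hQ
    rcases eq_or_eq_maximalIdeal_of_le P h₀ h₁ (Q := Q.asIdeal) hPQ with hQP | hQm
    · left
      rintro ⟨Q', hQ'⟩ _
      have hPQ' : P ≤ Q'.asIdeal := hQ'
      change Q.asIdeal ≤ Q'.asIdeal
      rw [hQP]
      exact hPQ'
    · right
      rintro ⟨Q', hQ'⟩ hle
      change Q ≤ Q' at hle
      change Q' ≤ Q
      have : Q'.asIdeal ≤ Q.asIdeal := by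
        rw [hQm]; exact IsLocalRing.le_maximalIdeal Q'.2.ne_top
      exact this
  · rw [Order.one_le_krullDim_iff]
    refine ⟨⟨⟨P, hP⟩, le_refl P⟩, ⟨⟨maximalIdeal _, inferInstance⟩, IsLocalRing.le_maximalIdeal hP.ne_top⟩, ?_⟩
    exact lt_of_le_of_ne (IsLocalRing.le_maximalIdeal hP.ne_top) (fun e => hPm (congrArg (fun Q => Q.1.asIdeal) e))

/-- From a squarefree `b ∈ P` whose partial derivatives lie in `P` (perfect ground field of characteristic `p`): a non-zero prime STRICTLY
below `P` — the principal prime of a prime factor of `b` (it cannot be all of `P`: a prime dividing `b` and all `∂ᵢ b` contradicts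
squarefreeness, stub-1's `NCBranchPrimes.not_prime_dvd_all`). -/
theorem exists_prime_lt_of_squarefree (p : ℕ) [Fact p.Prime] [CharP k p] [PerfectRing k p] {b : MvPowerSeries (Fin 3) k} (hb : Squarefree b)
    (hbP : b ∈ P) (hdb : ∀ i, MvPowerSeries.pderiv i b ∈ P) :
    ∃ Q₀ : Ideal (MvPowerSeries (Fin 3) k), Q₀.IsPrime ∧ ⊥ < Q₀ ∧ Q₀ < P := by
  classical
  haveI := TameFourTupleDrop.uniqueFactorizationMonoid_mvPowerSeries (k := k) 3
  have hb0 : b ≠ 0 := hb.ne_zero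
  have hP0 : P ≠ ⊥ := fun h => hb0 (by rw [h, Ideal.mem_bot] at hbP; exact hbP)
  obtain ⟨g, hgP, hg⟩ := hP.exists_mem_prime_of_ne_bot hP0
  refine ⟨Ideal.span {g}, (Ideal.span_singleton_prime hg.ne_zero).mpr hg, ?_, lt_of_le_of_ne ((Ideal.span_singleton_le_iff_mem _).mpr hgP) ?_⟩
  · rw [bot_lt_iff_ne_bot, Ne, Ideal.span_singleton_eq_bot]
    exact hg.ne_zero
  · intro hgPe
    refine NCBranchPrimes.not_prime_dvd_all p hb hg ?_ fun i => ?_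
    · exact Ideal.mem_span_singleton.mp (hgPe ▸ hbP)
    · exact Ideal.mem_span_singleton.mp (hgPe ▸ hdb i)

/-- **Dimension one from a squarefree element**: if the non-maximal prime `P` contains a squarefree `b` and its partial derivatives
(the top-locus primes: `b =` the monic germ, `b ∈ P^(2)`), then `dim k⟦X₀,X₁,X₂⟧ ⧸ P = 1`. -/
theorem ringKrullDim_quotient_eq_one_of_squarefree (p : ℕ) [Fact p.Prime] [CharP k p] [PerfectRing k p] {b : MvPowerSeries (Fin 3) k}
    (hb : Squarefree b) (hbP : b ∈ P) (hdb : ∀ i, MvPowerSeries.pderiv i b ∈ P) (hPm : P ≠ maximalIdeal (MvPowerSeries (Fin 3) k)) :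
    ringKrullDim (MvPowerSeries (Fin 3) k ⧸ P) = 1 := by
  obtain ⟨Q₀, hQ₀, h₀, h₁⟩ := exists_prime_lt_of_squarefree P p hb hbP hdb
  haveI := hQ₀
  exact ringKrullDim_quotient_eq_one P h₀ h₁ hPm

/-- The partial derivatives of an element of the symbolic square `P^(2)` lie in `P` (Leibniz; the tree's `Derivation.apply_mem_of_mul_mem_sq`). -/
theorem pderiv_mem_of_mul_mem_sq {b s : MvPowerSeries (Fin 3) k} (hs : s ∉ P) (hsb : s * b ∈ P ^ 2) (i : Fin 3) :
    MvPowerSeries.pderiv i b ∈ P := by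
  have hbP : b ∈ P := by
    have : s * b ∈ P := Ideal.pow_le_self two_ne_zero hsb
    exact (hP.mem_or_mem this).resolve_left hs
  exact Derivation.apply_mem_of_mul_mem_sq (MvPowerSeries.pderiv i) hbP hs hsb

end BranchRing

/-! ## §2 The canonical valuation `v_P(f) = addVal_{W_P}(f mod P)` -/

section Valuation

variable (P : Ideal (MvPowerSeries (Fin 3) k)) [hP : P.IsPrime]

/-- **The normalisation `W_P` of the branch ring is a discrete valuation ring** (for `dim = 1`; the tree's Kiyek–Vicente II (3.17)). -/
theorem isDiscreteValuationRing_integralClosure (hdim : ringKrullDim (MvPowerSeries (Fin 3) k ⧸ P) = 1) :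
    IsDiscreteValuationRing (integralClosure (MvPowerSeries (Fin 3) k ⧸ P) (FractionRing (MvPowerSeries (Fin 3) k ⧸ P))) := by
  haveI := isLocalRing_quotient P
  haveI := isNoetherianRing_quotient P
  haveI := isAdicComplete_quotient P
  exact isDiscreteValuationRing_integralClosure_of_complete _ hdim

/-- `W_P` is a finite module over the branch ring. -/
theorem module_finite_integralClosure (hdim : ringKrullDim (MvPowerSeries (Fin 3) k ⧸ P) = 1) :
    Module.Finite (MvPowerSeries (Fin 3) k ⧸ P)
      (integralClosure (MvPowerSeries (Fin 3) k ⧸ P) (FractionRing (MvPowerSeries (Fin 3) k ⧸ P))) := by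
  haveI := isLocalRing_quotient P
  haveI := isNoetherianRing_quotient P
  haveI := isAdicComplete_quotient P
  exact module_finite_integralClosure_of_complete _ hdim

omit hP in
/-- The branch ring embeds in `W_P`. -/
theorem algebraMap_integralClosure_injective :
    Function.Injective (algebraMap (MvPowerSeries (Fin 3) k ⧸ P)
      (integralClosure (MvPowerSeries (Fin 3) k ⧸ P) (FractionRing (MvPowerSeries (Fin 3) k ⧸ P)))) := fun x y h => by
  have := congrArg (fun w : integralClosure (MvPowerSeries (Fin 3) k ⧸ P) (FractionRing (MvPowerSeries (Fin 3) k ⧸ P)) =>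
    (w : FractionRing (MvPowerSeries (Fin 3) k ⧸ P))) h
  exact IsFractionRing.injective (MvPowerSeries (Fin 3) k ⧸ P) (FractionRing (MvPowerSeries (Fin 3) k ⧸ P)) this

/-- `D → W_P` is a local homomorphism (for `dim = 1`). -/
theorem isLocalHom_algebraMap_integralClosure' (hdim : ringKrullDim (MvPowerSeries (Fin 3) k ⧸ P) = 1) :
    haveI := isDiscreteValuationRing_integralClosure P hdim
    IsLocalHom (algebraMap (MvPowerSeries (Fin 3) k ⧸ P)
      (integralClosure (MvPowerSeries (Fin 3) k ⧸ P) (FractionRing (MvPowerSeries (Fin 3) k ⧸ P)))) := by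
  haveI := isLocalRing_quotient P
  haveI hW := isDiscreteValuationRing_integralClosure P hdim
  haveI : IsLocalRing (integralClosure (MvPowerSeries (Fin 3) k ⧸ P) (FractionRing (MvPowerSeries (Fin 3) k ⧸ P))) :=
    hW.toIsLocalRing
  exact isLocalHom_algebraMap_integralClosure _

/-- **`v_P(f) = ⊤` exactly on `P`.** -/
theorem addVal_mk_eq_top_iff (hdim : ringKrullDim (MvPowerSeries (Fin 3) k ⧸ P) = 1) (f : MvPowerSeries (Fin 3) k) :
    haveI := isDiscreteValuationRing_integralClosure P hdim
    IsDiscreteValuationRing.addVal (integralClosure (MvPowerSeries (Fin 3) k ⧸ P) (FractionRing (MvPowerSeries (Fin 3) k ⧸ P))) (algebraMap (MvPowerSeries (Fin 3) k ⧸ P) (integralClosure (MvPowerSeries (Fin 3) k ⧸ P) (FractionRing (MvPowerSeries (Fin 3) k ⧸ P))) (Ideal.Quotient.mk P f)) = ⊤ ↔ f ∈ P := by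
  haveI := isDiscreteValuationRing_integralClosure P hdim
  rw [IsDiscreteValuationRing.addVal_eq_top_iff, ← Ideal.Quotient.eq_zero_iff_mem,
    ← (algebraMap_integralClosure_injective P).eq_iff, map_zero]

/-- **Additivity**: `v_P(fg) = v_P(f) + v_P(g)`. -/
theorem addVal_mk_mul (hdim : ringKrullDim (MvPowerSeries (Fin 3) k ⧸ P) = 1) (f g : MvPowerSeries (Fin 3) k) :
    haveI := isDiscreteValuationRing_integralClosure P hdim
    IsDiscreteValuationRing.addVal (integralClosure (MvPowerSeries (Fin 3) k ⧸ P) (FractionRing (MvPowerSeries (Fin 3) k ⧸ P))) (algebraMap (MvPowerSeries (Fin 3) k ⧸ P) (integralClosure (MvPowerSeries (Fin 3) k ⧸ P) (FractionRing (MvPowerSeries (Fin 3) k ⧸ P))) (Ideal.Quotient.mk P (f * g))) =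
      IsDiscreteValuationRing.addVal (integralClosure (MvPowerSeries (Fin 3) k ⧸ P) (FractionRing (MvPowerSeries (Fin 3) k ⧸ P))) (algebraMap (MvPowerSeries (Fin 3) k ⧸ P) (integralClosure (MvPowerSeries (Fin 3) k ⧸ P) (FractionRing (MvPowerSeries (Fin 3) k ⧸ P))) (Ideal.Quotient.mk P f)) +
        IsDiscreteValuationRing.addVal (integralClosure (MvPowerSeries (Fin 3) k ⧸ P) (FractionRing (MvPowerSeries (Fin 3) k ⧸ P))) (algebraMap (MvPowerSeries (Fin 3) k ⧸ P) (integralClosure (MvPowerSeries (Fin 3) k ⧸ P) (FractionRing (MvPowerSeries (Fin 3) k ⧸ P))) (Ideal.Quotient.mk P g)) := by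
  haveI := isDiscreteValuationRing_integralClosure P hdim
  rw [map_mul, map_mul, IsDiscreteValuationRing.addVal_mul]

/-- **Powers**: `v_P(f^n) = n • v_P(f)`. -/
theorem addVal_mk_pow (hdim : ringKrullDim (MvPowerSeries (Fin 3) k ⧸ P) = 1) (f : MvPowerSeries (Fin 3) k) (n : ℕ) :
    haveI := isDiscreteValuationRing_integralClosure P hdim
    IsDiscreteValuationRing.addVal (integralClosure (MvPowerSeries (Fin 3) k ⧸ P) (FractionRing (MvPowerSeries (Fin 3) k ⧸ P))) (algebraMap (MvPowerSeries (Fin 3) k ⧸ P) (integralClosure (MvPowerSeries (Fin 3) k ⧸ P) (FractionRing (MvPowerSeries (Fin 3) k ⧸ P))) (Ideal.Quotient.mk P (f ^ n))) =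
      n • IsDiscreteValuationRing.addVal (integralClosure (MvPowerSeries (Fin 3) k ⧸ P) (FractionRing (MvPowerSeries (Fin 3) k ⧸ P))) (algebraMap (MvPowerSeries (Fin 3) k ⧸ P) (integralClosure (MvPowerSeries (Fin 3) k ⧸ P) (FractionRing (MvPowerSeries (Fin 3) k ⧸ P))) (Ideal.Quotient.mk P f)) := by
  haveI := isDiscreteValuationRing_integralClosure P hdim
  rw [map_pow, map_pow, IsDiscreteValuationRing.addVal_pow]

/-- **Ultrametric inequality**: `min (v_P f) (v_P g) ≤ v_P(f + g)`. -/
theorem min_addVal_mk_le_add (hdim : ringKrullDim (MvPowerSeries (Fin 3) k ⧸ P) = 1) (f g : MvPowerSeries (Fin 3) k) :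
    haveI := isDiscreteValuationRing_integralClosure P hdim
    min (IsDiscreteValuationRing.addVal (integralClosure (MvPowerSeries (Fin 3) k ⧸ P) (FractionRing (MvPowerSeries (Fin 3) k ⧸ P))) (algebraMap (MvPowerSeries (Fin 3) k ⧸ P) (integralClosure (MvPowerSeries (Fin 3) k ⧸ P) (FractionRing (MvPowerSeries (Fin 3) k ⧸ P))) (Ideal.Quotient.mk P f)))
      (IsDiscreteValuationRing.addVal (integralClosure (MvPowerSeries (Fin 3) k ⧸ P) (FractionRing (MvPowerSeries (Fin 3) k ⧸ P))) (algebraMap (MvPowerSeries (Fin 3) k ⧸ P) (integralClosure (MvPowerSeries (Fin 3) k ⧸ P) (FractionRing (MvPowerSeries (Fin 3) k ⧸ P))) (Ideal.Quotient.mk P g))) ≤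
      IsDiscreteValuationRing.addVal (integralClosure (MvPowerSeries (Fin 3) k ⧸ P) (FractionRing (MvPowerSeries (Fin 3) k ⧸ P))) (algebraMap (MvPowerSeries (Fin 3) k ⧸ P) (integralClosure (MvPowerSeries (Fin 3) k ⧸ P) (FractionRing (MvPowerSeries (Fin 3) k ⧸ P))) (Ideal.Quotient.mk P (f + g))) := by
  haveI := isDiscreteValuationRing_integralClosure P hdim
  rw [map_add, map_add]
  exact IsDiscreteValuationRing.addVal_add

omit hP in
/-- An element of `k⟦X₀,X₁,X₂⟧` is a unit modulo `P` iff it is a unit (both rings are local, `P` proper). -/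
theorem isUnit_mk_iff (hPt : P ≠ ⊤) (f : MvPowerSeries (Fin 3) k) : IsUnit (Ideal.Quotient.mk P f) ↔ IsUnit f := by
  refine ⟨fun h => ?_, fun h => h.map _⟩
  by_contra hf
  have hfm : f ∈ maximalIdeal (MvPowerSeries (Fin 3) k) := hf
  haveI : Nontrivial (MvPowerSeries (Fin 3) k ⧸ P) := Ideal.Quotient.nontrivial_iff.mpr hPt
  haveI : IsLocalRing (MvPowerSeries (Fin 3) k ⧸ P) := IsLocalRing.of_surjective' _ Ideal.Quotient.mk_surjective
  have : Ideal.Quotient.mk P f ∈ maximalIdeal (MvPowerSeries (Fin 3) k ⧸ P) := by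
    rw [← IsLocalRing.map_maximalIdeal_of_surjective (Ideal.Quotient.mk P) Ideal.Quotient.mk_surjective]
    exact Ideal.mem_map_of_mem _ hfm
  exact this h

/-- **`v_P(f) = 0` exactly on units** (off the maximal ideal). -/
theorem addVal_mk_eq_zero_iff (hdim : ringKrullDim (MvPowerSeries (Fin 3) k ⧸ P) = 1) (f : MvPowerSeries (Fin 3) k) :
    haveI := isDiscreteValuationRing_integralClosure P hdim
    IsDiscreteValuationRing.addVal (integralClosure (MvPowerSeries (Fin 3) k ⧸ P) (FractionRing (MvPowerSeries (Fin 3) k ⧸ P))) (algebraMap (MvPowerSeries (Fin 3) k ⧸ P) (integralClosure (MvPowerSeries (Fin 3) k ⧸ P) (FractionRing (MvPowerSeries (Fin 3) k ⧸ P))) (Ideal.Quotient.mk P f)) = 0 ↔ IsUnit f := by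
  haveI := isDiscreteValuationRing_integralClosure P hdim
  haveI := isLocalHom_algebraMap_integralClosure' P hdim
  rw [IsDiscreteValuationRing.addVal_eq_zero_iff, isUnit_map_iff, isUnit_mk_iff P hP.ne_top]

/-- **`1 ≤ v_P(f)` exactly on the maximal ideal.** -/
theorem one_le_addVal_mk_iff (hdim : ringKrullDim (MvPowerSeries (Fin 3) k ⧸ P) = 1) (f : MvPowerSeries (Fin 3) k) :
    haveI := isDiscreteValuationRing_integralClosure P hdim
    1 ≤ IsDiscreteValuationRing.addVal (integralClosure (MvPowerSeries (Fin 3) k ⧸ P) (FractionRing (MvPowerSeries (Fin 3) k ⧸ P))) (algebraMap (MvPowerSeries (Fin 3) k ⧸ P) (integralClosure (MvPowerSeries (Fin 3) k ⧸ P) (FractionRing (MvPowerSeries (Fin 3) k ⧸ P))) (Ideal.Quotient.mk P f)) ↔ f ∈ maximalIdeal (MvPowerSeries (Fin 3) k) := by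
  rw [Order.one_le_iff_ne_zero, Ne, addVal_mk_eq_zero_iff P hdim, IsLocalRing.mem_maximalIdeal, mem_nonunits_iff]

/-- Non-zero constants have value `0`. -/
theorem addVal_mk_C (hdim : ringKrullDim (MvPowerSeries (Fin 3) k ⧸ P) = 1) {c : k} (hc : c ≠ 0) :
    haveI := isDiscreteValuationRing_integralClosure P hdim
    IsDiscreteValuationRing.addVal (integralClosure (MvPowerSeries (Fin 3) k ⧸ P) (FractionRing (MvPowerSeries (Fin 3) k ⧸ P))) (algebraMap (MvPowerSeries (Fin 3) k ⧸ P) (integralClosure (MvPowerSeries (Fin 3) k ⧸ P) (FractionRing (MvPowerSeries (Fin 3) k ⧸ P))) (Ideal.Quotient.mk P (MvPowerSeries.C c))) = 0 := by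
  rw [addVal_mk_eq_zero_iff P hdim]
  exact (MvPowerSeries.isUnit_iff_constantCoeff).mpr (by simpa using hc)

/-- **The variables have positive value**, finite exactly when the variable is not in `P`. -/
theorem one_le_addVal_mk_X (hdim : ringKrullDim (MvPowerSeries (Fin 3) k ⧸ P) = 1) (i : Fin 3) :
    haveI := isDiscreteValuationRing_integralClosure P hdim
    1 ≤ IsDiscreteValuationRing.addVal (integralClosure (MvPowerSeries (Fin 3) k ⧸ P) (FractionRing (MvPowerSeries (Fin 3) k ⧸ P))) (algebraMap (MvPowerSeries (Fin 3) k ⧸ P) (integralClosure (MvPowerSeries (Fin 3) k ⧸ P) (FractionRing (MvPowerSeries (Fin 3) k ⧸ P))) (Ideal.Quotient.mk P (MvPowerSeries.X i))) := by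
  rw [one_le_addVal_mk_iff P hdim]
  exact X_mem_maximalIdeal k (Fin 3) i

/-- `v_P(X i) < ⊤` iff `X i ∉ P`. -/
theorem addVal_mk_X_lt_top_iff (hdim : ringKrullDim (MvPowerSeries (Fin 3) k ⧸ P) = 1) (i : Fin 3) :
    haveI := isDiscreteValuationRing_integralClosure P hdim
    IsDiscreteValuationRing.addVal (integralClosure (MvPowerSeries (Fin 3) k ⧸ P) (FractionRing (MvPowerSeries (Fin 3) k ⧸ P))) (algebraMap (MvPowerSeries (Fin 3) k ⧸ P) (integralClosure (MvPowerSeries (Fin 3) k ⧸ P) (FractionRing (MvPowerSeries (Fin 3) k ⧸ P))) (Ideal.Quotient.mk P (MvPowerSeries.X i))) < ⊤ ↔ MvPowerSeries.X i ∉ P := by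
  rw [lt_top_iff_ne_top, Ne, addVal_mk_eq_top_iff P hdim]

end Valuation

/-! ## §3 The parametrisation reading: `v_P = ord_T ∘ τ` -/

section Param

/-- For a ring isomorphism `e : K⟦T⟧ ≃ W` onto a discrete valuation ring sending `T` to a uniformizer, `addVal_W (e g) = ord_T g`. -/
theorem addVal_eq_order_of_ringEquiv {K W : Type*} [Field K] [CommRing W] [IsDomain W] [IsDiscreteValuationRing W]
    (e : PowerSeries K ≃+* W) (hX : Irreducible (e PowerSeries.X)) (g : PowerSeries K) :
    IsDiscreteValuationRing.addVal W (e g) = g.order := by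
  by_cases hg : g = 0
  · subst hg; simp
  · have hsplit : (PowerSeries.X : PowerSeries K) ^ g.order.toNat * PowerSeries.divXPowOrder g = g :=
      PowerSeries.X_pow_order_mul_divXPowOrder
    have hunit : IsUnit (PowerSeries.divXPowOrder g) := by
      rw [PowerSeries.isUnit_iff_constantCoeff, PowerSeries.constantCoeff_divXPowOrder]
      exact isUnit_iff_ne_zero.mpr (PowerSeries.coeff_order hg)
    conv_lhs => rw [← hsplit]
    rw [map_mul, map_pow, IsDiscreteValuationRing.addVal_mul, IsDiscreteValuationRing.addVal_pow,
      IsDiscreteValuationRing.addVal_uniformizer hX, (IsDiscreteValuationRing.addVal_eq_zero_iff).mpr (hunit.map e), add_zero,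
      ← PowerSeries.coe_toNat_order hg]
    simp

variable (P : Ideal (MvPowerSeries (Fin 3) k)) [hP : P.IsPrime]

/-- **THE PARAMETRISATION READING OF `v_P`**: there is a ring isomorphism `e : κ′⟦T⟧ ≃ W_P` (`κ′` the residue field of `W_P`, `e(T)` a
uniformizer, constants a coefficient field) such that the branch parametrisation `τ = e⁻¹ ∘ (D → W_P) ∘ (mod P)` is a local homomorphism with
kernel `P` and `v_P(f) = ord_T (τ f)` for every `f` (the tree's `exists_branchParametrization_of_complete` + `addVal_eq_order_of_ringEquiv`). -/
theorem exists_param_valuation_eq_order (hdim : ringKrullDim (MvPowerSeries (Fin 3) k ⧸ P) = 1) :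
    haveI := isDiscreteValuationRing_integralClosure P hdim
    ∃ e : PowerSeries (ResidueField (integralClosure (MvPowerSeries (Fin 3) k ⧸ P) (FractionRing (MvPowerSeries (Fin 3) k ⧸ P)))) ≃+*
        integralClosure (MvPowerSeries (Fin 3) k ⧸ P) (FractionRing (MvPowerSeries (Fin 3) k ⧸ P)),
      Irreducible (e PowerSeries.X) ∧
      (∀ c, residue _ (e (PowerSeries.C c)) = c) ∧
      IsLocalHom ((e.symm.toRingHom.comp (algebraMap (MvPowerSeries (Fin 3) k ⧸ P) _)).comp (Ideal.Quotient.mk P)) ∧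
      (∀ f, (e.symm.toRingHom.comp (algebraMap (MvPowerSeries (Fin 3) k ⧸ P) _)).comp (Ideal.Quotient.mk P) f = 0 ↔ f ∈ P) ∧
      ∀ f, IsDiscreteValuationRing.addVal (integralClosure (MvPowerSeries (Fin 3) k ⧸ P) (FractionRing (MvPowerSeries (Fin 3) k ⧸ P))) (algebraMap (MvPowerSeries (Fin 3) k ⧸ P) (integralClosure (MvPowerSeries (Fin 3) k ⧸ P) (FractionRing (MvPowerSeries (Fin 3) k ⧸ P))) (Ideal.Quotient.mk P f)) =
        (e.symm (algebraMap (MvPowerSeries (Fin 3) k ⧸ P) (integralClosure (MvPowerSeries (Fin 3) k ⧸ P) (FractionRing (MvPowerSeries (Fin 3) k ⧸ P))) (Ideal.Quotient.mk P f))).order := by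
  haveI := isLocalRing_quotient P
  haveI := isNoetherianRing_quotient P
  haveI := isAdicComplete_quotient P
  haveI := isDiscreteValuationRing_integralClosure P hdim
  -- the image of `k` in the branch ring is a subfield
  let ι : k →+* MvPowerSeries (Fin 3) k ⧸ P := (Ideal.Quotient.mk P).comp MvPowerSeries.C
  let k₀ : Subring (MvPowerSeries (Fin 3) k ⧸ P) := ι.range
  have hk₀ : IsField k₀ := by
    have hι : Function.Injective ι := ι.injective
    have hbij : Function.Bijective ι.rangeRestrict :=
      ⟨fun a b h => hι (congrArg Subtype.val h), ι.rangeRestrict_surjective⟩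
    exact MulEquiv.isField (Field.toIsField k) (RingEquiv.ofBijective ι.rangeRestrict hbij).symm.toMulEquiv
  obtain ⟨e, hX, hC, hinj, hloc, -⟩ := exists_branchParametrization_of_complete (MvPowerSeries (Fin 3) k ⧸ P) k₀ hk₀ hdim
  refine ⟨e, hX, hC, ?_, fun f => ?_, fun f => ?_⟩
  · haveI := hloc
    haveI : IsLocalHom (Ideal.Quotient.mk P) := by
      refine ⟨fun f hf => (isUnit_mk_iff P hP.ne_top f).mp hf⟩
    exact RingHom.isLocalHom_comp _ _
  · rw [RingHom.comp_apply, ← Ideal.Quotient.eq_zero_iff_mem]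
    constructor
    · intro h
      exact hinj (by rw [h, map_zero])
    · intro h
      rw [h, map_zero]
  · conv_lhs => rw [← e.apply_symm_apply (algebraMap _ _ (Ideal.Quotient.mk P f))]
    exact addVal_eq_order_of_ringEquiv e hX _

end Param


end TOT2Branch

end Summit.ResolutionOfSingularities.ResolutionOfSingularities.Theorems

end
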